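import Summits.QuantumFields.YangMills.Theorems.BalabanUVNodesN18HLayerW1Induction
import Summits.QuantumFields.YangMills.Theorems.BalabanUVNodesN18HLayerW1Lemma3Config

/-!
# BalabanUVNodes ∕ N18 — THE INDUCTION ON THE LEVEL, LEVEL T: the one-step schema IN N10's CURRENCY — «(1.18) ∧ analyticity on the tables at the levels
# `j ≤ k` ⟹ (2.14) termwise analyticity + termwise domination + (2.26) per term at step `k`» — through file 12's Lemma-3 socket into file 15's induction:
# (1.18), [I] p. 263 analyticity, the (2.38) pair at every step, and L05 ∕ L06 AT THE ADMISSIBLE PAIRING OF RECORD (Track A, DAG node N18 = NE5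
# `T4OutputRate.NE5 EA EB W κ θ C₅` :211; cluster K4 «SpineRates»; file 16 of seat pub-ymgap-dag-n18-c, row s1, generation 4; companion of file 15
# `…N18HLayerW1Induction`)

Cell `pub-ymgap`, HUMAN RULING D-0062 (Track A), R134 ACCELERATION seat `pub-ymgap-dag-n18-c` (strategy s1), generation 4.  THEOREMS ONLY (no `def`, no
`instance`, no `sorry`); imports file 15 `…N18HLayerW1Induction` (the induction on the level, configuration direction) and file 12 `…N18HLayerW1Lemma3Config`
(p476890: Lemma 3 at W1's objects in the configuration direction — `analyticH_of_analyticT`, `bound238_of_termwise226_config` over the kernel-checked socket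
`B13Lemma3TorusSocket`); restates nothing.  Coefficient algebra `𝔸 : Type` (the socket's `TwoTorusStep.Φ` lives in `Type`; the record's `M_N(ℂ)` qualifies).

WHY.  File 15 displays [I] Theorem 1's one step as (STEP): «inductive assumptions at the levels `≤ k` ⟹ the step-`k` H-layer pair `AnalyticH ∧ Bound238`».
N10 ∕ NODE A do not deliver (2.38) directly: [II] delivers, per TERM (2.14) of the step, its analyticity on the space ((2.14) p. 15 «We consider it as an
analytic function of (𝐔,𝐉) in the space U^c_{k+1}(X, α₀, α₁)») and the bound (2.26) p. 17 — both THROUGH THE OLD TERMS ((2.15): the potentials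
`V_k(Y, ·)` of (1.41)–(1.43) are assembled from `E^{(j)}`, `j ≤ k`, bounded by the inductive assumption (1.18)) — and Lemma 3 pp. 17–20 resums (2.26) to
(2.38).  The resummation is the tree's theorem (file 12 over `B13Lemma3TorusSocket.h238_of_hRep_half` ∕ `hRep_of_termwise`).  So the schema N10 can
literally instantiate is the LEVEL-T one:
  «(1.18)`(E₀, r₁)` ∧ analyticity on `sp j` at the levels `j ≤ k`, every history of `W`
     ⟹ `(S k).AnalyticT (Wk k) (sp (k+1))` ∧ termwise domination `‖(S k).H g φ Z‖ ≤ Σ_{t ∈ terms L M Z} ‖T k g Z t φ‖`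
        ∧ (2.26) per term `‖T k g Z t φ‖ ≤ weight(t)·e^{a₅|Z|}` on `sp (k+1) Z`»                                                       (STEP-T)
with term maps `T k g Z t : Φ → ℂ` over the socket's torus term catalogue `B13Lemma3TorusTerms.terms L M Z` ((𝐃, P) with `Z′₀ ⊆ Z` on the fine torus
`tsys 4 (L·N′)`, `N′ = domCount (F.P K) M (k+1)`) as data, and THIS FILE feeds it through file 12 §0 ∕ §2 into file 15.

WHAT (theorems only; at `F.P K`; ONE numerics bundle `Lemma3Numerics c M (½L) a a₂ a₂′ a₅ Aabs`, `8 ≤ L`; amplitude `A = C₃ε₁`, rate `R = (1 − 8δ)·½L·κ`;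
located rate clause `r₁ + 2·64·log 162 + 2 ≤ R`, STRICT [KP86] clause `C₃ε₁·e^{5r₁+1}·K₀(64,8)·9·64 < 1`, renewal `e·9·64·K₀(64,8)²·C₃ε₁ ≤ E₀`).
* §1 `hLayer_all_of_inductiveStepT` — (STEP-T) ⟹ the pair `(S k).AnalyticH (Wk k) (sp (k+1)) ∧ (S k).Bound238 (Wk k) (sp (k+1)) (C₃ε₁) ((1−8δ)·½L·κ)` AT
  EVERY STEP; `termBound118_of_inductiveStepT` — (1.18) `W1.TermBound118 S W sp E₀ r₁` for the whole tower; `termAnalytic_of_inductiveStepT` — [I] p. 263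
  `W1.TermAnalytic S W sp`.
* §2 ★ `decayBound_EA_ofRecordAdm_of_inductiveStepT` ∕ ★ `decayBound_EB_ofRecordAdm_of_inductiveStepT` — L05 ∕ L06 of the END AT THE ADMISSIBLE PAIRING OF
  RECORD `LevelPairing.ofRecordAdm F M N k sp gauge hg T₀ hT₀` from (STEP-T) for run A's ∕ run B's tower + the tables' restriction property + the numerics
  ALONE: no embedding clause (`LevelPairing.ofRecordAdm_embA_mem` ∕ `_embB_mem`), no pairing clause (`W1.dj_pairOfRecord`), no unconditional per-step data.

HONEST FRAMING — what this is NOT.  Count-neutral by-name knit AT THE OBJECT; NOT a discharge of N18 (typed 28∕28 · discharged 5∕27 UNCHANGED).  (STEP-T) is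
DISPLAYED and asserted nowhere: it is [II] (2.14)–(2.26) for THE terms of record (N10's Lemmas 1–2 ∕ NODE A's majorant on the class (1.5)) in their
printed CONDITIONAL form; the identification of W1's abstract index `S.Idx` with the socket's catalogue, the towers, the tables and the letters are data.
NE5 (the η-rate, two-run content) untouched: NOT IN PRINT, NOT PROVED.  One finite four-torus programme at fixed `ε`, Bałaban as printed — NOT the
continuum limit on ℝ⁴, NOT infinite volume, NOT OS, NOT a mass gap, NOT Clay.  0 `sorry`, 0 `def`; axioms standard.

References (TYPES ∕ loci only): [I] = [Balaban1987RG1] CMP **109** (1987) — (0.24)–(0.25) p. 257, Thm 1 p. 259, (1.18) and the analyticity sentence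
p. 263; [II] = [Balaban1988RG2Cluster] CMP **116** (1988) — (1.41)–(1.43) p. 11, (2.14)–(2.15) p. 15, (2.26) p. 17, Lemma 3 (2.38) p. 20, (2.41) p. 21, p. 22;
[KoteckyPreiss1986] Thm 1 p. 492.  Nothing here is a claim about the Yang–Mills mass gap.
-/

noncomputable section

namespace Summit.QuantumFields.YangMills.BalabanUVNodes.N18HLayerW1InductionTerms

open Set Metric
open scoped BigOperators
open Literature.MathematicalPhysics.QuantumFieldTheory.Balaban1983to89
open Literature.MathematicalPhysics.QuantumFieldTheory.Balaban1983to89.T4Continuum (T4Family)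
open Literature.MathematicalPhysics.QuantumFieldTheory.Balaban1983to89.T4OutputRate
open Literature.MathematicalPhysics.QuantumFieldTheory.Balaban1983to89.TreeLengthTorus (TDom)
open Literature.MathematicalPhysics.QuantumFieldTheory.Balaban1983to89.B12TreeDecay (K₀)
open Literature.MathematicalPhysics.QuantumFieldTheory.Balaban1983to89.B13Lemma3TorusData (TBond)
open Literature.MathematicalPhysics.QuantumFieldTheory.Balaban1983to89.B13Lemma3TorusTerms (terms weight)
open Literature.MathematicalPhysics.QuantumFieldTheory.Balaban1983to89.B13Lemma3TorusSocket (Lemma3Numerics)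
open Literature.MathematicalPhysics.QuantumFieldTheory.Balaban1983to89.Node00
open Literature.MathematicalPhysics.QuantumFieldTheory.Balaban1983to89.Node00.Sect2 (domSys domCount CPair ofBackgroundC)
open Literature.MathematicalPhysics.QuantumFieldTheory.Balaban1983to89.Node00.W1
open Summit.QuantumFields.YangMills.BalabanUVNodes.N18HLayerW1Lemma3Config (analyticH_of_analyticT bound238_of_termwise226_config)
open Summit.QuantumFields.YangMills.BalabanUVNodes.N18HLayerW1Induction (hLayer_all_of_inductiveStep termBound118_of_inductiveStep
  termAnalytic_of_inductiveStep decayBound_EA_ofRecordAdm_of_inductiveStep decayBound_EB_ofRecordAdm_of_inductiveStep)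

/-! ## §1 (STEP-T) ⟹ (STEP): the H-layer pair at every step, (1.18) and [I] p. 263 analyticity for the whole tower -/

section LevelT

variable (F : T4Family) (K : ℕ) {𝔸 : Type} [NormedRing 𝔸] [NormedAlgebra ℂ 𝔸] {M : ℕ} [NeZero M]

open Classical in
/-- **THE H-LAYER PAIR AT EVERY STEP FROM THE LEVEL-T SCHEMA.**  With term maps `T k g Z t : Φ → ℂ` over the socket's torus term catalogue `terms L M Z`
((𝐃, P) with `Z′₀ ⊆ Z` on the fine torus) as data: IF for every step `k` the inductive assumptions ((1.18)`(E₀, r₁)` + analyticity on the tables at levels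
`≤ k`, every history of `W`) IMPLY (2.14) termwise analyticity `(S k).AnalyticT (Wk k) (sp (k+1))`, termwise domination `‖(S k).H g φ Z‖ ≤ Σ_t ‖T k g Z t φ‖`
and (2.26) per term `‖T k g Z t φ‖ ≤ weight(t)·e^{a₅|Z|}` on the table ([II] (2.14)–(2.26) pp. 15–17 for the terms of record, through `|V_k(Y, ·)|` and
(1.42)–(1.43), i.e. THROUGH THE OLD TERMS — N10's Lemmas 1–2 ∕ NODE A in their printed conditional form; DISPLAYED), THEN under ONE numerics bundle
`Lemma3Numerics c M (½L) …` (`8 ≤ L`), the located rate clause at `R = (1 − 8δ)·½L·κ`, the STRICT clause at `A = C₃ε₁` and the renewal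
`e·9·64·K₀²·C₃ε₁ ≤ E₀`: the pair `(S k).AnalyticH ∧ (S k).Bound238 … (C₃ε₁) ((1−8δ)·½L·κ)` AT EVERY STEP — file 12 §0 (`analyticH_of_analyticT`, finite sum)
and §2 (`bound238_of_termwise226_config`: Lemma 3's resummation (2.28)–(2.37), kernel-checked socket) turn the LEVEL-T schema into (STEP), then §1.
[cite: Balaban1988RG2Cluster, (2.14) p.15, (2.26) p.17, Lemma 3 (2.38) p.20 and p.22; Balaban1987RG1, Thm 1 p.259] -/
theorem hLayer_all_of_inductiveStepT (S : ClusterTower (F.P K) 𝔸 M) (W : Set (ℕ → ℝ)) (Wk : (k : ℕ) → Set (Fin (k + 1) → ℝ))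
    (sp : (j : ℕ) → (domSys (F.P K) M j).Dom → Set (CPair (F.P K) 𝔸)) (c : B13.Consts) {L : ℕ} [NeZero L] (hL : 8 ≤ c.L)
    (hLc : c.L = L) {a a₂ a₂' a₅ Aabs : ℝ} (hN : Lemma3Numerics c M ((c.L : ℝ) / 2) a a₂ a₂' a₅ Aabs)
    (T : (k : ℕ) → (Fin (k + 1) → ℝ) → (Z : TDom 4 (domCount (F.P K) M (k + 1))) →
      Finset (TDom 4 (L * domCount (F.P K) M (k + 1))) × Finset (TBond 4 M (L * domCount (F.P K) M (k + 1))) → CPair (F.P K) 𝔸 → ℂ)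
    {r₁ E₀ : ℝ} (hW : ∀ k, ∀ g ∈ W, restrictPrefix k g ∈ Wk k) (hrestr : ∀ k, W1.SpRestr (sp (k + 1)))
    (hstepT : ∀ k : ℕ,
      (∀ g ∈ W, ∀ j ≤ k, ∀ (X : (domSys (F.P K) M j).Dom), ∀ φ ∈ sp j X,
          ‖termC S j X g φ‖ ≤ E₀ * Real.exp (-(r₁ * (domSys (F.P K) M j).dj X))) →
      (∀ g ∈ W, ∀ j ≤ k, ∀ (X : (domSys (F.P K) M j).Dom), AnalyticOnNhd ℂ (termC S j X g) (sp j X)) →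
      (S k).AnalyticT (Wk k) (sp (k + 1)) ∧
      (∀ g ∈ Wk k, ∀ (Z : (domSys (F.P K) M (k + 1)).Dom) (φ : CPair (F.P K) 𝔸), φ ∈ sp (k + 1) Z →
          ‖(S k).H g φ Z‖ ≤ ∑ t ∈ terms L M Z, ‖T k g Z t φ‖) ∧
      (∀ g ∈ Wk k, ∀ (Z : (domSys (F.P K) M (k + 1)).Dom) (φ : CPair (F.P K) 𝔸), φ ∈ sp (k + 1) Z → ∀ t ∈ terms L M Z,
          ‖T k g Z t φ‖ ≤ weight L M c Z a t * Real.exp (a₅ * ((Z.1).card : ℝ))))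
    (hr₁ : 0 ≤ r₁) (hA : 0 ≤ c.C3act * c.ε₁) (hrate : r₁ + 2 * (64 * Real.log 162) + 2 ≤ (1 - 8 * c.δ) * ((c.L : ℝ) / 2) * c.κ)
    (hsmall : c.C3act * c.ε₁ * Real.exp (5 * r₁ + 1) * K₀ 64 8 * 9 * 64 < 1)
    (hrenew : Real.exp 1 * 9 * 64 * K₀ 64 8 ^ 2 * (c.C3act * c.ε₁) ≤ E₀) :
    ∀ k, (S k).AnalyticH (Wk k) (sp (k + 1)) ∧
      (S k).Bound238 (Wk k) (sp (k + 1)) (c.C3act * c.ε₁) ((1 - 8 * c.δ) * ((c.L : ℝ) / 2) * c.κ) :=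
  hLayer_all_of_inductiveStep F K S W Wk sp hW hrestr
    (fun k hB hAn =>
      have h := hstepT k hB hAn
      ⟨analyticH_of_analyticT (S k) (Wk k) (sp (k + 1)) h.1,
        bound238_of_termwise226_config F K (S k) (Wk k) (sp (k + 1)) c hL hLc hN (T k) h.2.1 h.2.2⟩)
    hA hr₁ hrate hsmall hrenew

open Classical in
/-- **(1.18) FOR THE WHOLE TOWER FROM THE LEVEL-T SCHEMA**: `W1.TermBound118 S W sp E₀ r₁`. [cite: Balaban1987RG1, (1.18) p.263 and Thm 1 p.259; Balaban1988RG2Cluster, (2.26) p.17, Lemma 3 (2.38) p.20, (2.41) p.21] -/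
theorem termBound118_of_inductiveStepT (S : ClusterTower (F.P K) 𝔸 M) (W : Set (ℕ → ℝ)) (Wk : (k : ℕ) → Set (Fin (k + 1) → ℝ))
    (sp : (j : ℕ) → (domSys (F.P K) M j).Dom → Set (CPair (F.P K) 𝔸)) (c : B13.Consts) {L : ℕ} [NeZero L] (hL : 8 ≤ c.L)
    (hLc : c.L = L) {a a₂ a₂' a₅ Aabs : ℝ} (hN : Lemma3Numerics c M ((c.L : ℝ) / 2) a a₂ a₂' a₅ Aabs)
    (T : (k : ℕ) → (Fin (k + 1) → ℝ) → (Z : TDom 4 (domCount (F.P K) M (k + 1))) →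
      Finset (TDom 4 (L * domCount (F.P K) M (k + 1))) × Finset (TBond 4 M (L * domCount (F.P K) M (k + 1))) → CPair (F.P K) 𝔸 → ℂ)
    {r₁ E₀ : ℝ} (hW : ∀ k, ∀ g ∈ W, restrictPrefix k g ∈ Wk k) (hrestr : ∀ k, W1.SpRestr (sp (k + 1)))
    (hstepT : ∀ k : ℕ,
      (∀ g ∈ W, ∀ j ≤ k, ∀ (X : (domSys (F.P K) M j).Dom), ∀ φ ∈ sp j X,
          ‖termC S j X g φ‖ ≤ E₀ * Real.exp (-(r₁ * (domSys (F.P K) M j).dj X))) →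
      (∀ g ∈ W, ∀ j ≤ k, ∀ (X : (domSys (F.P K) M j).Dom), AnalyticOnNhd ℂ (termC S j X g) (sp j X)) →
      (S k).AnalyticT (Wk k) (sp (k + 1)) ∧
      (∀ g ∈ Wk k, ∀ (Z : (domSys (F.P K) M (k + 1)).Dom) (φ : CPair (F.P K) 𝔸), φ ∈ sp (k + 1) Z →
          ‖(S k).H g φ Z‖ ≤ ∑ t ∈ terms L M Z, ‖T k g Z t φ‖) ∧
      (∀ g ∈ Wk k, ∀ (Z : (domSys (F.P K) M (k + 1)).Dom) (φ : CPair (F.P K) 𝔸), φ ∈ sp (k + 1) Z → ∀ t ∈ terms L M Z,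
          ‖T k g Z t φ‖ ≤ weight L M c Z a t * Real.exp (a₅ * ((Z.1).card : ℝ))))
    (hr₁ : 0 ≤ r₁) (hA : 0 ≤ c.C3act * c.ε₁) (hrate : r₁ + 2 * (64 * Real.log 162) + 2 ≤ (1 - 8 * c.δ) * ((c.L : ℝ) / 2) * c.κ)
    (hsmall : c.C3act * c.ε₁ * Real.exp (5 * r₁ + 1) * K₀ 64 8 * 9 * 64 < 1)
    (hrenew : Real.exp 1 * 9 * 64 * K₀ 64 8 ^ 2 * (c.C3act * c.ε₁) ≤ E₀) :
    TermBound118 S W sp E₀ r₁ :=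
  termBound118_of_inductiveStep F K S W Wk sp hW hrestr
    (fun k hB hAn =>
      have h := hstepT k hB hAn
      ⟨analyticH_of_analyticT (S k) (Wk k) (sp (k + 1)) h.1,
        bound238_of_termwise226_config F K (S k) (Wk k) (sp (k + 1)) c hL hLc hN (T k) h.2.1 h.2.2⟩)
    hA hr₁ hrate hsmall hrenew

open Classical in
/-- **[I] p. 263 ANALYTICITY FOR THE WHOLE TOWER FROM THE LEVEL-T SCHEMA**: `W1.TermAnalytic S W sp`. [cite: Balaban1987RG1, §1 p.263 and Thm 1 p.259; Balaban1988RG2Cluster, (2.14) p.15 and p.15 (analyticity statement)] -/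
theorem termAnalytic_of_inductiveStepT (S : ClusterTower (F.P K) 𝔸 M) (W : Set (ℕ → ℝ)) (Wk : (k : ℕ) → Set (Fin (k + 1) → ℝ))
    (sp : (j : ℕ) → (domSys (F.P K) M j).Dom → Set (CPair (F.P K) 𝔸)) (c : B13.Consts) {L : ℕ} [NeZero L] (hL : 8 ≤ c.L)
    (hLc : c.L = L) {a a₂ a₂' a₅ Aabs : ℝ} (hN : Lemma3Numerics c M ((c.L : ℝ) / 2) a a₂ a₂' a₅ Aabs)
    (T : (k : ℕ) → (Fin (k + 1) → ℝ) → (Z : TDom 4 (domCount (F.P K) M (k + 1))) →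
      Finset (TDom 4 (L * domCount (F.P K) M (k + 1))) × Finset (TBond 4 M (L * domCount (F.P K) M (k + 1))) → CPair (F.P K) 𝔸 → ℂ)
    {r₁ E₀ : ℝ} (hW : ∀ k, ∀ g ∈ W, restrictPrefix k g ∈ Wk k) (hrestr : ∀ k, W1.SpRestr (sp (k + 1)))
    (hstepT : ∀ k : ℕ,
      (∀ g ∈ W, ∀ j ≤ k, ∀ (X : (domSys (F.P K) M j).Dom), ∀ φ ∈ sp j X,
          ‖termC S j X g φ‖ ≤ E₀ * Real.exp (-(r₁ * (domSys (F.P K) M j).dj X))) →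
      (∀ g ∈ W, ∀ j ≤ k, ∀ (X : (domSys (F.P K) M j).Dom), AnalyticOnNhd ℂ (termC S j X g) (sp j X)) →
      (S k).AnalyticT (Wk k) (sp (k + 1)) ∧
      (∀ g ∈ Wk k, ∀ (Z : (domSys (F.P K) M (k + 1)).Dom) (φ : CPair (F.P K) 𝔸), φ ∈ sp (k + 1) Z →
          ‖(S k).H g φ Z‖ ≤ ∑ t ∈ terms L M Z, ‖T k g Z t φ‖) ∧
      (∀ g ∈ Wk k, ∀ (Z : (domSys (F.P K) M (k + 1)).Dom) (φ : CPair (F.P K) 𝔸), φ ∈ sp (k + 1) Z → ∀ t ∈ terms L M Z,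
          ‖T k g Z t φ‖ ≤ weight L M c Z a t * Real.exp (a₅ * ((Z.1).card : ℝ))))
    (hr₁ : 0 ≤ r₁) (hA : 0 ≤ c.C3act * c.ε₁) (hrate : r₁ + 2 * (64 * Real.log 162) + 2 ≤ (1 - 8 * c.δ) * ((c.L : ℝ) / 2) * c.κ)
    (hsmall : c.C3act * c.ε₁ * Real.exp (5 * r₁ + 1) * K₀ 64 8 * 9 * 64 < 1)
    (hrenew : Real.exp 1 * 9 * 64 * K₀ 64 8 ^ 2 * (c.C3act * c.ε₁) ≤ E₀) :
    TermAnalytic S W sp :=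
  termAnalytic_of_inductiveStep F K S W Wk sp hW hrestr
    (fun k hB hAn =>
      have h := hstepT k hB hAn
      ⟨analyticH_of_analyticT (S k) (Wk k) (sp (k + 1)) h.1,
        bound238_of_termwise226_config F K (S k) (Wk k) (sp (k + 1)) c hL hLc hN (T k) h.2.1 h.2.2⟩)
    hA hr₁ hrate hsmall hrenew

end LevelT

/-! ## §2 L05 ∕ L06 AT THE ADMISSIBLE PAIRING OF RECORD from (STEP-T): no embedding clause, no pairing clause, no unconditional per-step data -/

section Admissible

open scoped Matrix.Norms.L2Operator

variable (F : T4Family) (M N k : ℕ) [NeZero M] (sp : (k j : ℕ) → (domSys (F.P k) M j).Dom → Set (CPair (F.P k) (MatA N)))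
  (gauge : GaugeField (F.P k) 0 (Node00.SU N) → GaugeField (F.P k) 0 (Node00.SU N) → ℝ) (hg : ∀ U U', 0 ≤ gauge U U')
  (T₀ : GaugeField (F.P (k + 1)) 0 (Node00.SU N) → GaugeField (F.P k) 0 (Node00.SU N))
  (hT₀ : ∀ U : GaugeField (F.P (k + 1)) 0 (Node00.SU N),
    (∀ (j : ℕ) (Y : (domSys (F.P (k + 1)) M j).Dom), ofBackgroundC (ιSU N) U ∈ sp (k + 1) j Y) →
      ∀ (j : ℕ) (Y : (domSys (F.P k) M j).Dom), ofBackgroundC (ιSU N) (T₀ U) ∈ sp k j Y)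
  (c : B13.Consts) {L : ℕ} [NeZero L]

open Classical in
/-- **★ L05 AT THE ADMISSIBLE PAIRING OF RECORD FROM (STEP-T).**  Run A's tower `S` on `F.P k` with term maps `T m` over the socket's catalogue; (STEP-T) on
the tables `sp k` (termwise analyticity + domination + (2.26) per term GIVEN the inductive assumptions below), the tables' restriction property, ONE
`Lemma3Numerics` bundle, the located rate clause, the STRICT clause and the renewal ⟹ `DecayBound ((LevelPairing.ofRecordAdm …).EA S) (Window γ)
(e·9·64·K₀(64,8)²·C₃ε₁) r₁` — the readings lie in the spaces BY TYPE. [cite: Balaban1987RG1, (0.25) p.257, (1.18) p.263 and Thm 1 p.259; Balaban1988RG2Cluster, (2.14) p.15, (2.26) p.17, Lemma 3 (2.38) p.20, p.22] -/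
theorem decayBound_EA_ofRecordAdm_of_inductiveStepT (hL : 8 ≤ c.L) (hLc : c.L = L) {a a₂ a₂' a₅ Aabs : ℝ}
    (hN : Lemma3Numerics c M ((c.L : ℝ) / 2) a a₂ a₂' a₅ Aabs) (S : ClusterTower (F.P k) (MatA N) M) {γ r₁ E₀ : ℝ}
    (T : (m : ℕ) → (Fin (m + 1) → ℝ) → (Z : TDom 4 (domCount (F.P k) M (m + 1))) →
      Finset (TDom 4 (L * domCount (F.P k) M (m + 1))) × Finset (TBond 4 M (L * domCount (F.P k) M (m + 1))) → CPair (F.P k) (MatA N) → ℂ)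
    (hrestr : ∀ m, W1.SpRestr (sp k (m + 1)))
    (hstepT : ∀ m : ℕ,
      (∀ g ∈ Window γ, ∀ j ≤ m, ∀ (X : (domSys (F.P k) M j).Dom), ∀ φ ∈ sp k j X,
          ‖termC S j X g φ‖ ≤ E₀ * Real.exp (-(r₁ * (domSys (F.P k) M j).dj X))) →
      (∀ g ∈ Window γ, ∀ j ≤ m, ∀ (X : (domSys (F.P k) M j).Dom), AnalyticOnNhd ℂ (termC S j X g) (sp k j X)) →
      (S m).AnalyticT (box γ m) (sp k (m + 1)) ∧
      (∀ g ∈ box γ m, ∀ (Z : (domSys (F.P k) M (m + 1)).Dom) (φ : CPair (F.P k) (MatA N)), φ ∈ sp k (m + 1) Z →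
          ‖(S m).H g φ Z‖ ≤ ∑ t ∈ terms L M Z, ‖T m g Z t φ‖) ∧
      (∀ g ∈ box γ m, ∀ (Z : (domSys (F.P k) M (m + 1)).Dom) (φ : CPair (F.P k) (MatA N)), φ ∈ sp k (m + 1) Z → ∀ t ∈ terms L M Z,
          ‖T m g Z t φ‖ ≤ weight L M c Z a t * Real.exp (a₅ * ((Z.1).card : ℝ))))
    (hr₁ : 0 ≤ r₁) (hA : 0 ≤ c.C3act * c.ε₁) (hrate : r₁ + 2 * (64 * Real.log 162) + 2 ≤ (1 - 8 * c.δ) * ((c.L : ℝ) / 2) * c.κ)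
    (hsmall : c.C3act * c.ε₁ * Real.exp (5 * r₁ + 1) * K₀ 64 8 * 9 * 64 < 1)
    (hrenew : Real.exp 1 * 9 * 64 * K₀ 64 8 ^ 2 * (c.C3act * c.ε₁) ≤ E₀) :
    DecayBound ((LevelPairing.ofRecordAdm F M N k sp gauge hg T₀ hT₀).EA S) (Window γ)
      (Real.exp 1 * 9 * 64 * K₀ 64 8 ^ 2 * (c.C3act * c.ε₁)) r₁ :=
  decayBound_EA_ofRecordAdm_of_inductiveStep F M N k sp gauge hg T₀ hT₀ S hrestr
    (fun m hB hAn =>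
      have h := hstepT m hB hAn
      ⟨analyticH_of_analyticT (S m) (box γ m) (sp k (m + 1)) h.1,
        bound238_of_termwise226_config F k (S m) (box γ m) (sp k (m + 1)) c hL hLc hN (T m) h.2.1 h.2.2⟩)
    hA hr₁ hrate hsmall hrenew

open Classical in
/-- **★ L06 AT THE ADMISSIBLE PAIRING OF RECORD FROM (STEP-T)** for run B's tower `S′` on `F.P (k+1)`, every member `b ∈ ]0, γ]`:
`DecayBound ((LevelPairing.ofRecordAdm …).EB S′ b) (Window γ) (e·9·64·K₀(64,8)²·C₃ε₁) r₁` — readings in the spaces by type, the pairing of record preserving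
`d_j`. [cite: Balaban1987RG1, (0.24)-(0.25) p.257, (1.18) p.263 and Thm 1 p.259; Balaban1988RG2Cluster, (2.14) p.15, (2.26) p.17, Lemma 3 (2.38) p.20, p.22] -/
theorem decayBound_EB_ofRecordAdm_of_inductiveStepT (hL : 8 ≤ c.L) (hLc : c.L = L) {a a₂ a₂' a₅ Aabs : ℝ}
    (hN : Lemma3Numerics c M ((c.L : ℝ) / 2) a a₂ a₂' a₅ Aabs) (S' : ClusterTower (F.P (k + 1)) (MatA N) M) {γ r₁ E₀ : ℝ}
    (T : (m : ℕ) → (Fin (m + 1) → ℝ) → (Z : TDom 4 (domCount (F.P (k + 1)) M (m + 1))) →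
      Finset (TDom 4 (L * domCount (F.P (k + 1)) M (m + 1))) × Finset (TBond 4 M (L * domCount (F.P (k + 1)) M (m + 1))) →
        CPair (F.P (k + 1)) (MatA N) → ℂ)
    (hrestr : ∀ m, W1.SpRestr (sp (k + 1) (m + 1)))
    (hstepT : ∀ m : ℕ,
      (∀ g ∈ Window γ, ∀ j ≤ m, ∀ (Y : (domSys (F.P (k + 1)) M j).Dom), ∀ φ ∈ sp (k + 1) j Y,
          ‖termC S' j Y g φ‖ ≤ E₀ * Real.exp (-(r₁ * (domSys (F.P (k + 1)) M j).dj Y))) →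
      (∀ g ∈ Window γ, ∀ j ≤ m, ∀ (Y : (domSys (F.P (k + 1)) M j).Dom), AnalyticOnNhd ℂ (termC S' j Y g) (sp (k + 1) j Y)) →
      (S' m).AnalyticT (box γ m) (sp (k + 1) (m + 1)) ∧
      (∀ g ∈ box γ m, ∀ (Z : (domSys (F.P (k + 1)) M (m + 1)).Dom) (φ : CPair (F.P (k + 1)) (MatA N)), φ ∈ sp (k + 1) (m + 1) Z →
          ‖(S' m).H g φ Z‖ ≤ ∑ t ∈ terms L M Z, ‖T m g Z t φ‖) ∧
      (∀ g ∈ box γ m, ∀ (Z : (domSys (F.P (k + 1)) M (m + 1)).Dom) (φ : CPair (F.P (k + 1)) (MatA N)), φ ∈ sp (k + 1) (m + 1) Z →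
          ∀ t ∈ terms L M Z, ‖T m g Z t φ‖ ≤ weight L M c Z a t * Real.exp (a₅ * ((Z.1).card : ℝ))))
    (hr₁ : 0 ≤ r₁) (hA : 0 ≤ c.C3act * c.ε₁) (hrate : r₁ + 2 * (64 * Real.log 162) + 2 ≤ (1 - 8 * c.δ) * ((c.L : ℝ) / 2) * c.κ)
    (hsmall : c.C3act * c.ε₁ * Real.exp (5 * r₁ + 1) * K₀ 64 8 * 9 * 64 < 1)
    (hrenew : Real.exp 1 * 9 * 64 * K₀ 64 8 ^ 2 * (c.C3act * c.ε₁) ≤ E₀) {b : ℝ} (hb : b ∈ Ioc (0 : ℝ) γ) :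
    DecayBound ((LevelPairing.ofRecordAdm F M N k sp gauge hg T₀ hT₀).EB S' b) (Window γ)
      (Real.exp 1 * 9 * 64 * K₀ 64 8 ^ 2 * (c.C3act * c.ε₁)) r₁ :=
  decayBound_EB_ofRecordAdm_of_inductiveStep F M N k sp gauge hg T₀ hT₀ S' hrestr
    (fun m hB hAn =>
      have h := hstepT m hB hAn
      ⟨analyticH_of_analyticT (S' m) (box γ m) (sp (k + 1) (m + 1)) h.1,
        bound238_of_termwise226_config F (k + 1) (S' m) (box γ m) (sp (k + 1) (m + 1)) c hL hLc hN (T m) h.2.1 h.2.2⟩)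
    hA hr₁ hrate hsmall hrenew hb

end Admissible

end Summit.QuantumFields.YangMills.BalabanUVNodes.N18HLayerW1InductionTerms

end
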